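import Summits.KontsevichZagierPeriods.KontsevichZagierPeriods.Theses.HurwitzMicroSectors
import Summits.KontsevichZagierPeriods.KontsevichZagierPeriods.Theorems.HurwitzMicroSectorsNormalFormPrinciplePiBoxTransfer

/-! TTRL-lite variant V2204 of stmt-KontsevichZagierPeriods-3869

Variant V2204 = `stub_boxRigidity` (BoxRigidity: two representations on open unit boxes with
integrands of KZ's rational shape and equal values are KZ-equivalent) under the JOINT bound
`fix_nat:m=2; bound_nat:m'≤2`. Verdict of the attempt seat: **open — but, unlike the one-sided moves
(V2200 `fix m`, V2241/V2256 `bound m'`, each provably the whole parent), a GENUINE fragment**. This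
file is the certificate of exactly what the variant is:

* `stub_boxRigidity_var2204_iff_boxVanishing_two`: V2204 ⟺ **BoxVanishing(2)** — every box-rational
  representation on the open square `(0,1)²` of value `0` is a relation (pad the lower-dimensional
  side to the square by `pad_le`, subtract on the common square by `sub_same`, both tree; conversely
  compare with the zero representation on the square);
* `stub_boxRigidity_var2204_iff_le_two`: V2204 ⟺ BoxRigidity with BOTH dimensions `≤ 2` (the
  symmetric two-sided bound; the move loses nothing by freezing `m = 2` rather than `m ≤ 2`);
* `stub_boxRigidity_var2204_of_statement` / `_of_parent`: Summit ⇒ parent ⇒ V2204, so the variant is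
  not refutable short of refuting Conjecture 1 for the tree's calculus;
* `sectorTwo_of_stub_boxRigidity_var2204`, `catalanSector_unconditional_of_stub_boxRigidity_var2204`:
  V2204 proves Conjecture 1 on EVERY weight-two Hurwitz sector `P(xy)/(1 − (xy)ᴸ)` of the square
  with no linear-independence input — in particular the level-4 (Catalan) rung, which the route can
  only close under the open hypothesis `Indep_ℚ(1, π², G)` (`CatalanSectorTwoFour`). BoxVanishing(2)
  contains, for every `q : ℚ`, "`G = q ⇒ [1/(1+x²y²)]_□ ∼ [q]`", provable today only through the
  irrationality of Catalan's constant (open) or an explicit chain of moves (none known); this is the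
  residual goal. (Contrast: both dimensions `≤ 1` is the theorem `boxRigidity_of_le_one`, by Baker.)
Source: M. Kontsevich, D. Zagier, *Periods* (2001), §1.2 Conjecture 1. Pure proof file, no definitions. -/

-- `Summit.<Summit>.<Problem>` is the tree's mandated summit-side namespace (CONVENTIONS §2); for this
-- single-conjunct summit the two coincide, so the duplicate is deliberate.
set_option linter.dupNamespace false

noncomputable section

namespace Summit.KontsevichZagierPeriods.KontsevichZagierPeriods.Theorems

open MeasureTheory Set
open Literature.NumberTheory.Transcendental Literature.NumberTheory.Transcendental.KZ
open Summit.KontsevichZagierPeriods.KontsevichZagierPeriods.Theses.HurwitzMicroSectors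
open Summit.KontsevichZagierPeriods.HurwitzMicroSectors.NormalFormPrinciple.PiBox
open Summit.KontsevichZagierPeriods.HurwitzMicroSectors.NormalFormPrinciple.PiBox.stub_boxCombineAux
  (pad_le sub_same)

/-! ## Bounded rigidity is vanishing at the top dimension -/

/-- **BoxVanishing at dimension `K` ⇒ BoxRigidity for all dimensions `m, m' ≤ K`.** Pad both
box-rational representations to the `K`-box by unit intervals (`pad_le`: one Newton–Leibniz move and
two null faces per step), subtract the integrands on the common box (`sub_same`, rule 1b); the
difference has value `0` by soundness, so it is a relation. [cite: KontsevichZagier2001, §1.2] -/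
theorem boxRigidityLe_of_boxVanishingAt (K : ℕ)
    (hvan : ∀ N : IntegralRep K, N.domain = {x | ∀ i, x i ∈ Set.Ioo (0:ℝ) 1} → N.IsRational →
      N.value = 0 → of N ∈ relations)
    {m m' : ℕ} (hm : m ≤ K) (hm' : m' ≤ K) (N : IntegralRep m) (N' : IntegralRep m')
    (hNd : N.domain = {x | ∀ i, x i ∈ Set.Ioo (0:ℝ) 1}) (hNr : N.IsRational)
    (hN'd : N'.domain = {x | ∀ i, x i ∈ Set.Ioo (0:ℝ) 1}) (hN'r : N'.IsRational)
    (hv : N.value = N'.value) : Equivalent N N' := by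
  obtain ⟨R₁, h₁d, h₁r, h₁⟩ := pad_le hm N hNd hNr
  obtain ⟨R₂, h₂d, h₂r, h₂⟩ := pad_le hm' N' hN'd hN'r
  obtain ⟨M, hMd, hMr, hM⟩ := sub_same R₁ R₂ h₁d h₁r h₂d h₂r
  have hMv : M.value = 0 := by
    have e₁ := relations_le_ker_eval_holds h₁
    have e₂ := relations_le_ker_eval_holds h₂
    have e := relations_le_ker_eval_holds hM
    rw [AddMonoidHom.mem_ker, map_sub, eval_of, eval_of, sub_eq_zero] at e₁ e₂
    rw [AddMonoidHom.mem_ker, map_sub, map_sub, eval_of, eval_of, eval_of, ← e₁, ← e₂, hv,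
      sub_self, zero_sub, neg_eq_zero] at e
    exact e
  have h₃ := relations.add_mem hM (hvan M hMd hMr hMv)
  rw [sub_add_cancel] at h₃
  have e : of N - of N' = (of N - of R₁) + (of R₁ - of R₂) - (of N' - of R₂) := by abel
  show of N - of N' ∈ relations
  rw [e]
  exact relations.sub_mem (relations.add_mem h₁ h₃) h₂

/-- **BoxRigidity at `(K, K)` ⇒ BoxVanishing at `K`**: compare a box-rational representation of value
`0` with the zero representation on the `K`-box (box-rational, value `0`, itself a relation).
[cite: KontsevichZagier2001, §1.2] -/
theorem boxVanishingAt_of_boxRigidityAt (K : ℕ)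
    (hrig : ∀ N N' : IntegralRep K, N.domain = {x | ∀ i, x i ∈ Set.Ioo (0:ℝ) 1} → N.IsRational →
      N'.domain = {x | ∀ i, x i ∈ Set.Ioo (0:ℝ) 1} → N'.IsRational → N.value = N'.value →
      Equivalent N N')
    (N : IntegralRep K) (hNd : N.domain = {x | ∀ i, x i ∈ Set.Ioo (0:ℝ) 1}) (hNr : N.IsRational)
    (hv : N.value = 0) : of N ∈ relations := by
  obtain ⟨Z, hZd, hZi⟩ := exists_zeroRep (isSemialgebraic_box K)
  have hZ : of Z ∈ relations := of_mem_relations_of_eqOn_zero Z (by simp [hZi, EqOn])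
  have hZv : Z.value = 0 := by simp [IntegralRep.value, hZi]
  have hZr : Z.IsRational := ⟨0, 1, fun x _ => by simp, fun x _ => by simp [hZi]⟩
  have h : of N - of Z ∈ relations := hrig N Z hNd hNr hZd hZr (by rw [hv, hZv])
  simpa using relations.add_mem h hZ

/-- **BoxVanishing at `K` ⇒ BoxVanishing at every `m ≤ K`** (pad to the `K`-box; the value is kept by
soundness). [cite: KontsevichZagier2001, §1.2] -/
theorem boxVanishingLe_of_boxVanishingAt (K : ℕ)
    (hvan : ∀ N : IntegralRep K, N.domain = {x | ∀ i, x i ∈ Set.Ioo (0:ℝ) 1} → N.IsRational →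
      N.value = 0 → of N ∈ relations)
    {m : ℕ} (hm : m ≤ K) (N : IntegralRep m) (hNd : N.domain = {x | ∀ i, x i ∈ Set.Ioo (0:ℝ) 1})
    (hNr : N.IsRational) (hv : N.value = 0) : of N ∈ relations := by
  obtain ⟨R, hRd, hRr, hR⟩ := pad_le hm N hNd hNr
  have hRv : R.value = 0 := by
    have e := relations_le_ker_eval_holds hR
    rw [AddMonoidHom.mem_ker, map_sub, eval_of, eval_of, hv, zero_sub, neg_eq_zero] at e
    exact e
  have := relations.add_mem hR (hvan R hRd hRr hRv)
  rwa [sub_add_cancel] at this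

/-! ## The variant V2204 itself: the weight-two box fragment -/

/-- **V2204 ⟺ BoxVanishing(2)**: the joint bound `m = 2, m' ≤ 2` of `stub_boxRigidity` is exactly the
statement that every box-rational representation on the open unit SQUARE of value `0` is a relation.
[cite: KontsevichZagier2001, §1.2 Conjecture 1] -/
theorem stub_boxRigidity_var2204_iff_boxVanishing_two :
    (∀ (m' : ℕ) (N : IntegralRep 2) (N' : IntegralRep m'), m' ≤ 2 → N.domain = {x | ∀ i, x i ∈ Set.Ioo (0:ℝ) 1} → N.IsRational → N'.domain = {x | ∀ i, x i ∈ Set.Ioo (0:ℝ) 1} → N'.IsRational → N.value = N'.value → Equivalent N N') ↔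
    (∀ N : IntegralRep 2, N.domain = {x | ∀ i, x i ∈ Set.Ioo (0:ℝ) 1} → N.IsRational →
      N.value = 0 → of N ∈ relations) :=
  ⟨fun h => boxVanishingAt_of_boxRigidityAt 2 fun N N' => h 2 N N' le_rfl,
    fun h _ N N' hm' => boxRigidityLe_of_boxVanishingAt 2 h le_rfl hm' N N'⟩

/-- **V2204 ⟺ BoxRigidity with both dimensions `≤ 2`** (the symmetric joint bound: freezing `m = 2`
instead of bounding it loses nothing, by padding). [cite: KontsevichZagier2001, §1.2 Conjecture 1] -/
theorem stub_boxRigidity_var2204_iff_le_two :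
    (∀ (m' : ℕ) (N : IntegralRep 2) (N' : IntegralRep m'), m' ≤ 2 → N.domain = {x | ∀ i, x i ∈ Set.Ioo (0:ℝ) 1} → N.IsRational → N'.domain = {x | ∀ i, x i ∈ Set.Ioo (0:ℝ) 1} → N'.IsRational → N.value = N'.value → Equivalent N N') ↔
    (∀ (m m' : ℕ) (N : IntegralRep m) (N' : IntegralRep m'), m ≤ 2 → m' ≤ 2 →
      N.domain = {x | ∀ i, x i ∈ Set.Ioo (0:ℝ) 1} → N.IsRational →
      N'.domain = {x | ∀ i, x i ∈ Set.Ioo (0:ℝ) 1} → N'.IsRational →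
      N.value = N'.value → Equivalent N N') :=
  ⟨fun h _ _ N N' hm hm' => boxRigidityLe_of_boxVanishingAt 2
      (stub_boxRigidity_var2204_iff_boxVanishing_two.1 h) hm hm' N N',
    fun h m' N N' hm' => h 2 m' N N' le_rfl hm'⟩

/-- **V2204 ⇒ BoxVanishing in every dimension `≤ 2`** (so V2204 contains the theorem
`boxRigidity_of_le_one` and adds exactly the square). [cite: KontsevichZagier2001, §1.2 Conjecture 1] -/
theorem boxVanishingLe_two_of_stub_boxRigidity_var2204
    (h : ∀ (m' : ℕ) (N : IntegralRep 2) (N' : IntegralRep m'), m' ≤ 2 → N.domain = {x | ∀ i, x i ∈ Set.Ioo (0:ℝ) 1} → N.IsRational → N'.domain = {x | ∀ i, x i ∈ Set.Ioo (0:ℝ) 1} → N'.IsRational → N.value = N'.value → Equivalent N N')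
    {m : ℕ} (hm : m ≤ 2) (N : IntegralRep m) (hNd : N.domain = {x | ∀ i, x i ∈ Set.Ioo (0:ℝ) 1})
    (hNr : N.IsRational) (hv : N.value = 0) : of N ∈ relations :=
  boxVanishingLe_of_boxVanishingAt 2 (stub_boxRigidity_var2204_iff_boxVanishing_two.1 h) hm N hNd hNr hv

/-- **Parent ⇒ V2204** (the variant is a specialisation of the leaf `stub_boxRigidity`).
[cite: KontsevichZagier2001, §1.2 Conjecture 1] -/
theorem stub_boxRigidity_var2204_of_parent
    (h : ∀ (m m' : ℕ) (N : IntegralRep m) (N' : IntegralRep m'), N.domain = {x | ∀ i, x i ∈ Set.Ioo (0:ℝ) 1} → N.IsRational → N'.domain = {x | ∀ i, x i ∈ Set.Ioo (0:ℝ) 1} → N'.IsRational → N.value = N'.value → Equivalent N N') :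
    ∀ (m' : ℕ) (N : IntegralRep 2) (N' : IntegralRep m'), m' ≤ 2 → N.domain = {x | ∀ i, x i ∈ Set.Ioo (0:ℝ) 1} → N.IsRational → N'.domain = {x | ∀ i, x i ∈ Set.Ioo (0:ℝ) 1} → N'.IsRational → N.value = N'.value → Equivalent N N' :=
  fun m' N N' _ => h 2 m' N N'

/-- **`KontsevichZagierPeriods ⇒ V2204`**: the variant is a special case of Conjecture 1 for the
tree's calculus — a refutation of the variant would refute the Summit.
[cite: KontsevichZagier2001, §1.2 Conjecture 1] -/
theorem stub_boxRigidity_var2204_of_statement (h : _root_.KontsevichZagierPeriods) :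
    ∀ (m' : ℕ) (N : IntegralRep 2) (N' : IntegralRep m'), m' ≤ 2 → N.domain = {x | ∀ i, x i ∈ Set.Ioo (0:ℝ) 1} → N.IsRational → N'.domain = {x | ∀ i, x i ∈ Set.Ioo (0:ℝ) 1} → N'.IsRational → N.value = N'.value → Equivalent N N' :=
  stub_boxRigidity_var2204_of_parent (leaves_of_statement h).1

/-! ## What the fragment contains: every weight-two Hurwitz sector, unconditionally -/

/-- A representation on the open square with integrand `P(x₀x₁)/(1 − (x₀x₁)ᴸ)` (`L ≠ 0`) has KZ's
rational shape: numerator `P(X₀X₁)`, denominator `1 − (X₀X₁)ᴸ`, non-vanishing on the square since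
`0 ≤ x₀x₁ < 1`. [cite: KontsevichZagier2001, §1.1] -/
theorem isRational_of_sectorTwo (L : ℕ) (hL : L ≠ 0) (r : IntegralRep 2) (P : Polynomial ℚ)
    (hr : r.domain = {x | ∀ i, x i ∈ Set.Ioo (0:ℝ) 1})
    (hP : EqOn r.integrand (fun x => Polynomial.aeval (x 0 * x 1) P / (1 - (x 0 * x 1) ^ L)) r.domain) :
    r.IsRational := by
  refine ⟨Polynomial.aeval (MvPolynomial.X 0 * MvPolynomial.X 1 : MvPolynomial (Fin 2) ℚ) P,
    1 - (MvPolynomial.X 0 * MvPolynomial.X 1) ^ L, fun x hx => ?_, fun x hx => ?_⟩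
  · rw [hr] at hx
    simp only [mem_setOf_eq] at hx
    have h0 := hx 0
    have h1 := hx 1
    simp only [map_sub, map_one, map_pow, map_mul, MvPolynomial.aeval_X]
    have ht0 : 0 ≤ x 0 * x 1 := mul_nonneg h0.1.le h1.1.le
    have ht1 : x 0 * x 1 < 1 := mul_lt_one_of_nonneg_of_lt_one_left h0.1.le h0.2 h1.2.le
    exact (sub_pos.2 (pow_lt_one₀ ht0 ht1 hL)).ne'
  · show r.integrand x = MvPolynomial.aeval x (Polynomial.aeval _ P) / MvPolynomial.aeval x _
    rw [hP hx, ← Polynomial.aeval_algHom_apply]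
    simp

/-- **V2204 ⇒ Conjecture 1 on every weight-two Hurwitz sector of the square, with NO
linear-independence hypothesis**: two representations on `(0,1)²` with integrands
`P(xy)/(1 − (xy)ᴸ)`, `P'(xy)/(1 − (xy)ᴸ)` and equal values are KZ-equivalent (`L ≠ 0` arbitrary).
The route closes such rungs only one level at a time and only given the matching independence
theorem (level 6: Calegari–Dimitrov–Tang; level 4: `Indep_ℚ(1, π², G)`, open).
[cite: KontsevichZagier2001, §1.2 Conjecture 1] -/
theorem sectorTwo_of_stub_boxRigidity_var2204
    (h : ∀ (m' : ℕ) (N : IntegralRep 2) (N' : IntegralRep m'), m' ≤ 2 → N.domain = {x | ∀ i, x i ∈ Set.Ioo (0:ℝ) 1} → N.IsRational → N'.domain = {x | ∀ i, x i ∈ Set.Ioo (0:ℝ) 1} → N'.IsRational → N.value = N'.value → Equivalent N N')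
    (L : ℕ) (hL : L ≠ 0) :
    ∀ (r r' : IntegralRep 2) (P P' : Polynomial ℚ), r.domain = {x | ∀ i, x i ∈ Set.Ioo (0:ℝ) 1} →
      r'.domain = {x | ∀ i, x i ∈ Set.Ioo (0:ℝ) 1} →
      EqOn r.integrand (fun x => Polynomial.aeval (x 0 * x 1) P / (1 - (x 0 * x 1) ^ L)) r.domain →
      EqOn r'.integrand (fun x => Polynomial.aeval (x 0 * x 1) P' / (1 - (x 0 * x 1) ^ L)) r'.domain →
      r.value = r'.value → Equivalent r r' :=
  fun r r' P P' hr hr' hP hP' hv =>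
    h 2 r r' le_rfl hr (isRational_of_sectorTwo L hL r P hr hP) hr'
      (isRational_of_sectorTwo L hL r' P' hr' hP') hv

/-- **V2204 ⇒ the Catalan rung unconditionally**: the CONCLUSION of the route item
`CatalanSectorTwoFour` (level 4, weight 2) without its open hypothesis `Indep_ℚ(1, π², G)`.
[cite: KontsevichZagier2001, §1.2 Conjecture 1] -/
theorem catalanSector_unconditional_of_stub_boxRigidity_var2204
    (h : ∀ (m' : ℕ) (N : IntegralRep 2) (N' : IntegralRep m'), m' ≤ 2 → N.domain = {x | ∀ i, x i ∈ Set.Ioo (0:ℝ) 1} → N.IsRational → N'.domain = {x | ∀ i, x i ∈ Set.Ioo (0:ℝ) 1} → N'.IsRational → N.value = N'.value → Equivalent N N') :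
    ∀ (r r' : IntegralRep 2) (P P' : Polynomial ℚ), r.domain = {x | ∀ i, x i ∈ Set.Ioo (0:ℝ) 1} →
      r'.domain = {x | ∀ i, x i ∈ Set.Ioo (0:ℝ) 1} →
      EqOn r.integrand (fun x => Polynomial.aeval (x 0 * x 1) P / (1 - (x 0 * x 1) ^ 4)) r.domain →
      EqOn r'.integrand (fun x => Polynomial.aeval (x 0 * x 1) P' / (1 - (x 0 * x 1) ^ 4)) r'.domain →
      r.value = r'.value → Equivalent r r' :=
  sectorTwo_of_stub_boxRigidity_var2204 h 4 (by norm_num)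

end Summit.KontsevichZagierPeriods.KontsevichZagierPeriods.Theorems
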